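import Summits.QuantumFields.YangMills.Theses.ScalingWindowSplit

/-!
# Ideator-1, negation-side sharpening — crux stmt-QuantumFields-18927 (W₁)

`LightFluxWeak G`: the strategist's `LightFlux G` (Cruxes/GapAtCorrelationLength/LightFluxObstruction.lean, Part A)
with the CONSTANT sector-spread `δ₀` weakened to a SUBEXPONENTIAL one: for every rate `ε > 0` (chosen after the coupling)
and on arbitrarily large odd tori there is a bounded slab functional, almost conserved in Euclidean time to accuracy
`e^{−εS}/4`, whose mean obeys `⟨Y⟩² ≤ 1 − e^{−εS}`.  Physically (G = SO(3)): the minority 't Hooft-flux sector has weight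
`≥ e^{−o(S)}` on large symmetric tori — "NO MAGNETIC MEISSNER EFFECT" — instead of 't Hooft's light flux `w₋ → 1/2`
(confinement) asked by `LightFlux`; a Coulomb phase also qualifies.  The same bookkeeping refutes W₁:
`gapAtCorrelationLength_false_of_lightFluxWeak`.  So the disprover's target `H` may be taken strictly weaker than `LightFlux`.
-/

noncomputable section

open scoped BigOperators Topology
open MeasureTheory Filter Set Function
open Literature.MathematicalPhysics.QuantumLattice Literature.MathematicalPhysics.AQFT
open Literature.MathematicalPhysics.QuantumFieldTheory

namespace Summit.QuantumFields.YangMills.Cruxes.GapAtCorrelationLength.Ideator1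

open Summit.QuantumFields.YangMills.Theses.ScalingWindowSplit (GapAtCorrelationLength)

/-- **Subexponentially populated, almost-conserved flux functional** (weakening of `Strategist.LightFlux`: the sector
spread `δ₀` is replaced by `e^{−εS}` for an arbitrary rate `ε > 0` fixed after the coupling). [folklore] -/
def LightFluxWeak (G : Type) [Group G] [TopologicalSpace G] [IsTopologicalGroup G] [CompactSpace G] : Prop :=
  letI : MeasurableSpace G := borel G
  haveI : BorelSpace G := ⟨rfl⟩
  ∀ (r : LatticeRep G), ∃ β₀ : ℝ, ∀ β : ℝ, β₀ ≤ β → ∀ ε : ℝ, 0 < ε → ∀ M₀ : ℕ,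
    ∃ (S T n : ℕ), M₀ ≤ S ∧ 2 * (T + n + 1) ≤ S ∧ S ≤ 4 * n ∧
    ∃ (Y : LGConfig 4 G → ℝ), Measurable Y ∧ (∀ U, |Y U| ≤ 1) ∧
      DependsOn Y {e : Literature.MathematicalPhysics.QuantumLattice.ZdEdge 4 |
        1 ≤ e.1 0 ∧ e.1 0 + (if e.2 = 0 then 1 else 0) ≤ T} ∧
      (∫ U, Y (torusLift (2 * S + 1) (GaugeConfig.timeReflect U)) * Y (torusLift (2 * S + 1) U)
          ∂(wilsonMeasure r.ρ β : Measure (GaugeConfig 4 (2 * S + 1) G))) ≤ 1 ∧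
      1 - Real.exp (-(ε * S)) / 4 ≤ (∫ U, Y (torusLift (2 * S + 1) (GaugeConfig.timeReflect U)) *
          Y (configShift (-Pi.single 0 (n : ℤ)) (torusLift (2 * S + 1) U))
          ∂(wilsonMeasure r.ρ β : Measure (GaugeConfig 4 (2 * S + 1) G))) ∧
      (∫ U, Y (torusLift (2 * S + 1) U)
          ∂(wilsonMeasure r.ρ β : Measure (GaugeConfig 4 (2 * S + 1) G))) ^ 2 ≤ 1 - Real.exp (-(ε * S))

/-- **NEGATIVE LEMMA, weakened hypothesis (`H → ¬W₁`)**: an admissible gauge group carrying a subexponentially populated,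
almost-conserved flux functional refutes `GapAtCorrelationLength`.  Bookkeeping: at step `k` take `ε := Δ a_k / 8`; the
RP-spectral clause at `(S, T, n, Y, B = 1)` gives `(3/4)e^{−εS} ≤ I_n − ⟨Y⟩² ≤ e^{−Δ a_k S/4} + |C| e^{−Δ a_k S}
= e^{−εS}(e^{−Δ a_k S/8} + |C| e^{−7Δ a_k S/8}) < (3/4) e^{−εS}` for large `S`. [folklore] -/
theorem gapAtCorrelationLength_false_of_lightFluxWeak
    (G : Type) [Group G] [TopologicalSpace G] [IsTopologicalGroup G] [CompactSpace G]
    (hG : IsCompactSimpleLieGroup G) (hH : LightFluxWeak G) :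
    ¬ GapAtCorrelationLength := by
  intro hW
  letI : MeasurableSpace G := borel G
  haveI : BorelSpace G := ⟨rfl⟩
  obtain ⟨r, sch, u, p, M, Δ, C, hweak, hvol, hΔ, hgap, hRP, hsupp, hfw⟩ := hW G hG
  obtain ⟨β₀, hβ₀⟩ := hH r
  obtain ⟨k, hRPk, hβk⟩ := (hRP.and (hweak.eventually_ge_atTop β₀)).exists
  have ha : 0 < sch.a k := sch.a_pos k
  have hΔa : 0 < Δ * sch.a k := mul_pos hΔ ha
  -- the rate of the witness: ε := Δ a_k / 8
  set ε : ℝ := Δ * sch.a k / 8 with hε_def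
  have hε : 0 < ε := by positivity
  -- h(S) := e^{-Δ a S/8} + |C| e^{-7 Δ a S/8} → 0
  set h : ℝ → ℝ := fun x => Real.exp (-(Δ * sch.a k * x / 8)) + |C| * Real.exp (-(7 * (Δ * sch.a k) * x / 8))
    with hh_def
  have hh : Tendsto h atTop (𝓝 0) := by
    have h1 : Tendsto (fun x : ℝ => Δ * sch.a k * x / 8) atTop atTop :=
      (tendsto_id.const_mul_atTop hΔa).atTop_div_const (by norm_num)
    have h7 : Tendsto (fun x : ℝ => 7 * (Δ * sch.a k) * x / 8) atTop atTop :=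
      (tendsto_id.const_mul_atTop (by positivity : (0:ℝ) < 7 * (Δ * sch.a k))).atTop_div_const (by norm_num)
    have e1 : Tendsto (fun x : ℝ => Real.exp (-(Δ * sch.a k * x / 8))) atTop (𝓝 0) :=
      Real.tendsto_exp_atBot.comp (tendsto_neg_atTop_atBot.comp h1)
    have e2 : Tendsto (fun x : ℝ => |C| * Real.exp (-(7 * (Δ * sch.a k) * x / 8))) atTop (𝓝 (|C| * 0)) :=
      (Real.tendsto_exp_atBot.comp (tendsto_neg_atTop_atBot.comp h7)).const_mul |C|
    simpa [hh_def] using e1.add e2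
  have hhN : Tendsto (fun S : ℕ => h S) atTop (𝓝 0) := hh.comp tendsto_natCast_atTop_atTop
  obtain ⟨N₀, hN₀⟩ := eventually_atTop.1 (hhN.eventually (gt_mem_nhds (by norm_num : (0:ℝ) < 3 / 4)))
  -- the witness on a torus beyond `max N₀ L_k`
  obtain ⟨S, T, n, hMS, h2, h4, Y, hYm, hYb, hYdep, hI0, hIn, hm⟩ := hβ₀ (sch.β k) hβk ε hε (max N₀ (sch.L k))
  have hLS : sch.L k ≤ S := (le_max_right _ _).trans hMS
  have hNS : N₀ ≤ S := (le_max_left _ _).trans hMS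
  have key := hRPk S T n hLS h2 Y 1 hYm hYb hYdep
  generalize hIn_def : (∫ U, Y (torusLift (2 * S + 1) (GaugeConfig.timeReflect U)) *
      Y (configShift (-Pi.single 0 (n : ℤ)) (torusLift (2 * S + 1) U))
      ∂(wilsonMeasure r.ρ (sch.β k) : Measure (GaugeConfig 4 (2 * S + 1) G))) = In at key hIn
  generalize hI0_def : (∫ U, Y (torusLift (2 * S + 1) (GaugeConfig.timeReflect U)) *
      Y (torusLift (2 * S + 1) U)
      ∂(wilsonMeasure r.ρ (sch.β k) : Measure (GaugeConfig 4 (2 * S + 1) G))) = I0 at key hI0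
  generalize hm_def : (∫ U, Y (torusLift (2 * S + 1) U)
      ∂(wilsonMeasure r.ρ (sch.β k) : Measure (GaugeConfig 4 (2 * S + 1) G))) = m at key hm
  -- exponent algebra: e^{-Δ a n} ≤ e^{-Δ a S/4} = e^{-εS} e^{-Δ a S/8},  e^{-Δ a S} = e^{-εS} e^{-7Δ a S/8}
  have hS4 : (S : ℝ) ≤ 4 * n := by exact_mod_cast h4
  have hexp_n : Real.exp (-(Δ * sch.a k * n)) ≤ Real.exp (-(Δ * sch.a k * S / 4)) := by
    apply Real.exp_le_exp.2
    nlinarith [mul_le_mul_of_nonneg_left hS4 hΔa.le]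
  have hsplit4 : Real.exp (-(Δ * sch.a k * S / 4)) = Real.exp (-(ε * S)) * Real.exp (-(Δ * sch.a k * S / 8)) := by
    rw [← Real.exp_add, hε_def]; ring_nf
  have hsplit1 : Real.exp (-(Δ * sch.a k * S)) = Real.exp (-(ε * S)) * Real.exp (-(7 * (Δ * sch.a k) * S / 8)) := by
    rw [← Real.exp_add, hε_def]; ring_nf
  have hE : 0 < Real.exp (-(ε * S)) := Real.exp_pos _
  have hexp0 : 0 ≤ Real.exp (-(Δ * sch.a k * n)) := Real.exp_nonneg _
  have hdiff : I0 - m ^ 2 ≤ 1 := by nlinarith [sq_nonneg m]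
  -- upper bound from the clause
  have hup : In - m ^ 2 ≤ Real.exp (-(ε * S)) * h S := by
    have t1 : Real.exp (-(Δ * sch.a k * n)) * (I0 - m ^ 2) ≤ Real.exp (-(ε * S)) * Real.exp (-(Δ * sch.a k * S / 8)) := by
      calc Real.exp (-(Δ * sch.a k * n)) * (I0 - m ^ 2)
          ≤ Real.exp (-(Δ * sch.a k * n)) * 1 := mul_le_mul_of_nonneg_left hdiff hexp0
        _ ≤ Real.exp (-(Δ * sch.a k * S / 4)) := by simpa using hexp_n
        _ = _ := hsplit4
    have t2 : C * (1 : ℝ) ^ 2 * Real.exp (-(Δ * sch.a k * S)) ≤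
        Real.exp (-(ε * S)) * (|C| * Real.exp (-(7 * (Δ * sch.a k) * S / 8))) := by
      rw [hsplit1]
      have hC := le_abs_self C
      have hE7 : 0 ≤ Real.exp (-(7 * (Δ * sch.a k) * S / 8)) := Real.exp_nonneg _
      nlinarith [mul_nonneg hE.le hE7]
    have hlhs : In - m ^ 2 ≤ |In - m ^ 2| := le_abs_self _
    have : In - m ^ 2 ≤ Real.exp (-(ε * S)) * Real.exp (-(Δ * sch.a k * S / 8)) +
        Real.exp (-(ε * S)) * (|C| * Real.exp (-(7 * (Δ * sch.a k) * S / 8))) := by linarith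
    simpa [hh_def, mul_add] using this
  -- lower bound from the witness: (3/4) e^{-εS} ≤ In - m²
  have hlow : 3 / 4 * Real.exp (-(ε * S)) ≤ In - m ^ 2 := by linarith
  have hhS : h S < 3 / 4 := hN₀ S hNS
  have : Real.exp (-(ε * S)) * h S < Real.exp (-(ε * S)) * (3 / 4) := mul_lt_mul_of_pos_left hhS hE
  linarith

end Summit.QuantumFields.YangMills.Cruxes.GapAtCorrelationLength.Ideator1

end
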